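import Summits.QuantumAdvantage.QuantumAdvantage.Theorems.CutDialB
import HarnessLib

/-!
# CutDial (C) — decomp-qadv lens-2, generation 31, part 3/3: the pieces over `NoPerfectTwo3` and the deciding theorem

The cut dial's three classes of degree-`≤ 2` strategies (cut-local / cut-additive / the rest), the three pieces, the proved
special piece `cutLocalTwo3Fail_holds`, `closes : CutLocalTwo3Fail → CutAdditiveTwo3Fail → RestTwo3Fail → NoPerfectTwo3`
(BY NAME, stmt-27432), `closes₂` with the proved piece discharged, exactness `noPerfectTwo3_iff_pieces`, axiom audit.
-/

set_option linter.dupNamespace false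
set_option linter.style.longLine false

namespace Summit.QuantumAdvantage.QuantumAdvantage.Theorems.CutDial
open Finset
open Literature.Computability.QuantumComplexity Literature.Computability.QuantumComplexity.RingHLF
open Summit.QuantumAdvantage.AdviceFreeQNC0 (OddZeros rot)
open Summit.QuantumAdvantage.AdviceFreeQNC0.RingSymmetry (shift)

variable {n : ℕ}

/-! ## The pieces over `NoPerfectTwo3` (stmt-27432) and the deciding theorem

The dichotomy of this node classifies a polynomial strategy `P` by its CUT-CROSSING STRUCTURE across a bipartition `(S, Sᶜ)`
facing `3|3` at some window:
* SPECIAL (bottom notch, `CutLocal`): the strategy MAP `x ↦ ([P_b(x) = 1])_b` is `S`-bipartite-local — killed for every degree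
  by `cutLocal_loses` (★★, so the piece `CutLocalTwo3Fail` is a THEOREM, `cutLocalTwo3Fail_holds`);
* MIDDLE notch (`CutAdditive`): every `P_b` is ADDITIVELY separable, `P_b = A_b + B_b` with `A_b` reading only `S`-inputs and
  `B_b` only `Sᶜ`-inputs (cross monomials absent, outputs on either side may read both sides through the sum) — the piece
  `CutAdditiveTwo3Fail` is OPEN (the magic square does not sum across an additive seam: the deciding test is census ask CD12);
* GENERIC (`RestTwo3Fail`): degree-`≤ 2` strategies with a cut-crossing monomial at EVERY facing bipartition.
`closes` reaches `NoPerfectTwo3` BY NAME from the three pieces; `closes₂` discharges the proved one; `noPerfectTwo3_iff_pieces`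
records that nothing is lost (each piece is the target restricted to a class of strategies).
-/

section Pieces
open Literature.Computability.MetaComplexity Literature.Computability.MetaComplexity.Smolensky
open Summit.QuantumAdvantage.QuantumAdvantage.Theses.ExactnessDial (NoPerfectTwo3)

/-- `A : CubeFn` READS ONLY the inputs in `S`. -/
def ReadsOnlyOnCut (S : Finset (Fin n)) (A : CubeFn (ZMod 3) n) : Prop :=
  ∀ x y : Fin n → Bool, (∀ c ∈ S, x c = y c) → A x = A y

/-- `B : CubeFn` READS ONLY the inputs off `S`. -/
def ReadsOnlyOffCut (S : Finset (Fin n)) (B : CubeFn (ZMod 3) n) : Prop :=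
  ∀ x y : Fin n → Bool, (∀ c, c ∉ S → x c = y c) → B x = B y

/-- SPECIAL CLASS (bottom notch of the cut dial): the strategy map of `P` is bipartite-local across SOME bipartition facing
`3|3` at some window. -/
def CutLocal (P : Fin n → CubeFn (ZMod 3) n) : Prop :=
  ∃ S : Finset (Fin n), ∃ m : ℕ, Faces33At m S ∧ BiLocal S (fun x i => decide (P i x = 1))

/-- MIDDLE CLASS of the cut dial: across SOME bipartition facing `3|3` at some window every output polynomial is ADDITIVELY
separable, `P_b = A_b + B_b` with `A_b` reading only `S` and `B_b` reading only `Sᶜ` (no cut-crossing monomial). -/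
def CutAdditive (P : Fin n → CubeFn (ZMod 3) n) : Prop :=
  ∃ S : Finset (Fin n), ∃ m : ℕ, Faces33At m S ∧
    ∀ b : Fin n, ∃ A B : CubeFn (ZMod 3) n, ReadsOnlyOnCut S A ∧ ReadsOnlyOffCut S B ∧ P b = A + B

/-- PIECE (special, PROVED below): eventually in `n`, every degree-`≤ 2` strategy that is cut-local loses on the odd class. -/
def CutLocalTwo3Fail : Prop :=
  ∃ n₀ : ℕ, ∀ n ≥ n₀, ∀ P : Fin n → CubeFn (ZMod 3) n, (∀ i, P i ∈ lowDeg (ZMod 3) n 2) → CutLocal P →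
    ∃ x : Fin n → Bool, OddZeros x ∧ ¬ Rel x (fun i => decide (P i x = 1))

/-- PIECE (middle, OPEN): eventually in `n`, every degree-`≤ 2` strategy that is cut-additive but not cut-local loses on the
odd class. -/
def CutAdditiveTwo3Fail : Prop :=
  ∃ n₀ : ℕ, ∀ n ≥ n₀, ∀ P : Fin n → CubeFn (ZMod 3) n, (∀ i, P i ∈ lowDeg (ZMod 3) n 2) → ¬ CutLocal P →
    CutAdditive P → ∃ x : Fin n → Bool, OddZeros x ∧ ¬ Rel x (fun i => decide (P i x = 1))

/-- PIECE (generic, OPEN): eventually in `n`, every degree-`≤ 2` strategy that is neither cut-local nor cut-additive (a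
cut-crossing monomial at every facing bipartition) loses on the odd class. -/
def RestTwo3Fail : Prop :=
  ∃ n₀ : ℕ, ∀ n ≥ n₀, ∀ P : Fin n → CubeFn (ZMod 3) n, (∀ i, P i ∈ lowDeg (ZMod 3) n 2) → ¬ CutLocal P →
    ¬ CutAdditive P → ∃ x : Fin n → Bool, OddZeros x ∧ ¬ Rel x (fun i => decide (P i x = 1))

/-- ★★ THE SPECIAL PIECE IS A THEOREM (from `n₀ = 7`, for every degree): `CutLocalTwo3Fail`. -/
theorem cutLocalTwo3Fail_holds : CutLocalTwo3Fail := by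
  refine ⟨7, fun n hn P _ hP => ?_⟩
  obtain ⟨S, m, hS, hz⟩ := hP
  exact cutLocal_loses hn m hS hz

/-- ★ DECIDING THEOREM: the three pieces of the cut dial give `NoPerfectTwo3` (stmt-27432) BY NAME. -/
theorem closes (h₁ : CutLocalTwo3Fail) (h₂ : CutAdditiveTwo3Fail) (h₃ : RestTwo3Fail) : NoPerfectTwo3 := by
  obtain ⟨n₁, H₁⟩ := h₁
  obtain ⟨n₂, H₂⟩ := h₂
  obtain ⟨n₃, H₃⟩ := h₃
  refine ⟨n₁ + n₂ + n₃, fun n hn P hP => ?_⟩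
  by_cases hL : CutLocal P
  · exact H₁ n (by omega) P hP hL
  · by_cases hA : CutAdditive P
    · exact H₂ n (by omega) P hP hL hA
    · exact H₃ n (by omega) P hP hL hA

/-- the deciding theorem with the proved special piece discharged: the two OPEN pieces give `NoPerfectTwo3`. -/
theorem closes₂ (h₂ : CutAdditiveTwo3Fail) (h₃ : RestTwo3Fail) : NoPerfectTwo3 := closes cutLocalTwo3Fail_holds h₂ h₃

/-- each piece is the target restricted to a class of strategies: the middle piece follows from the target … -/
theorem cutAdditiveTwo3Fail_of_target (h : NoPerfectTwo3) : CutAdditiveTwo3Fail := by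
  obtain ⟨n₀, H⟩ := h; exact ⟨n₀, fun n hn P hP _ _ => H n hn P hP⟩

/-- … and so does the generic piece. -/
theorem restTwo3Fail_of_target (h : NoPerfectTwo3) : RestTwo3Fail := by
  obtain ⟨n₀, H⟩ := h; exact ⟨n₀, fun n hn P hP _ _ => H n hn P hP⟩

/-- EXACTNESS of the node: `NoPerfectTwo3 ⟺ CutAdditiveTwo3Fail ∧ RestTwo3Fail` (the special class being settled). -/
theorem noPerfectTwo3_iff_pieces : NoPerfectTwo3 ↔ CutAdditiveTwo3Fail ∧ RestTwo3Fail :=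
  ⟨fun h => ⟨cutAdditiveTwo3Fail_of_target h, restTwo3Fail_of_target h⟩, fun h => closes₂ h.1 h.2⟩

/-- the cut-local class is NOT contained in the light-cone classes the tree already kills: it contains, for instance, every
strategy map of the form `x ↦ (F (x|S), G (x|Sᶜ))` with ARBITRARY functions `F, G` of the two halves (any degree, any range of
dependence inside a half).  Recorded as the closure property used by the memo: bipartite locality only constrains the two
cross blocks. -/
theorem biLocal_of_halves (S : Finset (Fin n)) (F G : (Fin n → Bool) → Fin n → Bool)
    (hF : ∀ x y : Fin n → Bool, (∀ b ∈ S, x b = y b) → F x = F y)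
    (hG : ∀ x y : Fin n → Bool, (∀ b, b ∉ S → x b = y b) → G x = G y) :
    BiLocal S (fun x b => if b ∈ S then F x b else G x b) := by
  refine ⟨fun x y h b hb => ?_, fun x y h b hb => ?_⟩
  · simp only [hb, if_true, hF x y h]
  · simp only [hb, if_false, hG x y h]

end Pieces

/-! ## Axiom audit of the headline theorems (standard axioms only) -/

/-- info: 'Summit.QuantumAdvantage.QuantumAdvantage.Theorems.CutDial.magic_of_square' depends on axioms: [propext,
 Classical.choice,
 Quot.sound] -/
#guard_msgs in #print axioms magic_of_square

/-- info: 'Summit.QuantumAdvantage.QuantumAdvantage.Theorems.CutDial.cutLocal_loses' depends on axioms: [propext,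
 Classical.choice,
 Quot.sound] -/
#guard_msgs in #print axioms cutLocal_loses

/-- info: 'Summit.QuantumAdvantage.QuantumAdvantage.Theorems.CutDial.cutLocalTwo3Fail_holds' depends on axioms: [propext,
 Classical.choice,
 Quot.sound] -/
#guard_msgs in #print axioms cutLocalTwo3Fail_holds

/-- info: 'Summit.QuantumAdvantage.QuantumAdvantage.Theorems.CutDial.closes' depends on axioms: [propext,
 Classical.choice,
 Quot.sound] -/
#guard_msgs in #print axioms closes

/-- info: 'Summit.QuantumAdvantage.QuantumAdvantage.Theorems.CutDial.closes₂' depends on axioms: [propext,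
 Classical.choice,
 Quot.sound] -/
#guard_msgs in #print axioms closes₂

/-- info: 'Summit.QuantumAdvantage.QuantumAdvantage.Theorems.CutDial.noPerfectTwo3_iff_pieces' depends on axioms: [propext,
 Classical.choice,
 Quot.sound] -/
#guard_msgs in #print axioms noPerfectTwo3_iff_pieces

end Summit.QuantumAdvantage.QuantumAdvantage.Theorems.CutDial
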